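import Summits.QuantumFields.YangMills.Theorems.UnitScaleTiltHalvingCompetitorMapTower
import HarnessLib

/-!
# Route `UnitScaleTilt`, crux K1 child «MinimiserStabilityRegPr» (stmt-QuantumFields-19200), registered stub `stub_halvingStep` (H), (Φ-1) FIBRE HALF for the localised
# competitor map (LEAD ★w5-19200 g4 RULING L-1 (R1)) — **THE QUOTIENT OF THE ACCUMULATED FRAMES IS IN THE GROUP**: the coarse re-gauge of
# ✓`HalvingCompetitorMapTower` (the quotient `V_k(W)·V_k(W′)⁻¹` of the accumulated frames of two fields with the same constraint data) satisfies every multiplicative,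
# inverse-closed predicate `p` (the knit: «unitary with `det = 1`», so that it lifts to an `SU(2)` gauge transformation) under a LEVEL-BY-LEVEL DICHOTOMY — a block either lies
# in `Ω_{j+1}` (then both towers below it read SMALL fields and every frame satisfies `p`: hypotheses `hvf`, `hvf'` on a family of «small-readable» blocks `Sm ⊇ Ω`) or it does
# not (then all its level-`j` bonds are non-deep, the two double-bar fields agree on them by the tower pinning lemma, and the two frames at the block COINCIDE)

Cell `ym3-torus` (HUMAN RULING D-0037, YM ladder rung R3 — continuum SU(2) YM₃ on the torus is a RUNG, not the Clay problem), width seat `ym-ust-19200-w1` gen 7.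
`--supports stmt-QuantumFields-19200 --as helper`; def-free, 0 sorry, standard axioms; counts toward nothing by itself.

WHY.  ✓`HalvingCompetitorMapTower.emlIterU_top_eq_gaugeActT_of_index_eq_gaugeActT` writes the `k`-fold (0.4) average of the localised competitor as a COARSE GAUGE COPY of
the minimiser's; to conclude «a FINE `SU(2)` gauge copy of the competitor lies in the fibre `𝔅_k(V)`» the coarse gauge must be `SU(2)`-valued.  It is the product of the block-centre
tower of `u⁻¹` (in the group) and the frame quotient `V_k(W)·V_k(W′)⁻¹`.  Far from the centre the frames are eml's of NON-small transporters (the far torus, free holonomies) —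
no unitarity there — but there the two fields coincide on everything the frames read, so the quotient is `1`; near the centre both towers read the small charted fields, whose
frames are unitary with `det = 1` (✓`ChartDoubleBarSU2.dbarIterU_mem_unitaryGroup_of_reads`∕`det_dbarIterU_eq_one_of_reads` + `ExpMeanLog.eml_mem_unitaryGroup`∕`det_eml_eq_one`,
instantiated in the next file).  This file is the pure tower algebra of that dichotomy, for ANY nested family, ANY two units-fields with equal constraint data, ANY predicate.

WHAT IS PROVED (ns `…Theorems.HalvingCompetitorMapFrames`; any `P`, complete normed `ℂ`-algebra `𝔸`, `D : Domains P`; `V`, `V′` = accumulated frames (97) of `W`, `W′` given by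
their recursions, as ✓`exists_accFrames_dbarIterU` produces them).
* §1 `vframeU_dbarIterU_eq_of_not_mem_Om` — constraint data equal + `y ∉ Ω_{j+1}` (`j+1 ≤ k`) ⇒ `v(U̿^{(j)}W)(y) = v(U̿^{(j)}W′)(y)` (✓tower pinning + ✓`vframeU_congr`).
* §2 `accFrames_pred_of_small` — on an `emb`-closed family `Sm` of blocks where every frame of `W` satisfies `p`, every accumulated frame of `W` satisfies `p`.
* §3 ★★ `accFrames_quotient_pred` — `Ω_{j+1} ⊆ Sm_{j+1}`, frames of BOTH fields satisfy `p` on `Sm`, constraint data equal ⇒ `p (V_j(W)(y)·V_j(W′)(y)⁻¹)` at EVERY site of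
  EVERY level `j ≤ k`; ★ `accFrames_quotient_pred_top` (level `k`).
* §4 ★★ `emlIterU_top_eq_gaugeActT_frames` — the explicit-frames form of the tower file's §3: `Ū^{(k)} W = (Ū^{(k)} W₀)^{g}` with
  `g y = V_k(W)(y)·V_k(W′)(y)⁻¹·(g₀)_k(y)` for GIVEN accumulated frames (`W′ = W₀^{g₀}`, `(g₀)_k` the block-centre tower); ★★★ `exists_pred_gauge_emlIterU_top` — under §3's
  hypotheses and `p` along the block-centre tower of `g₀`: `∃ g, (∀ y, p (g y)) ∧ Ū^{(k)} W = (Ū^{(k)} W₀)^{g}`.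
HONEST SCOPE: algebra; the smallness∕unitarity facts (`hvf`, `hvf′`) and the identification `Sm ⊇ Ω` are the next file's (cube-sequence geometry + the ♭ chart's B1∕B2
budgets); nothing of print is asserted; NOT a claim about the stub, the crux, the rung or a mass gap.

References: T. Bałaban, CMP **98** (1985) 17–51 [Balaban1985Averaging] ((11) p.19, (89) p.31, (92) p.31, (97)–(100) p.32, (110) p.34); CMP **96** (1984) 223–250
[Balaban1984PropagatorsII] ((2.1)–(2.4) p.224); CMP **102** (1985) 277–309 [Balaban1985Variational] ((6) p.278, (144) p.300).
-/

set_option autoImplicit false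

noncomputable section

namespace Summit.QuantumFields.YangMills.Theorems.HalvingCompetitorMapFrames

open Literature.MathematicalPhysics.QuantumFieldTheory.Balaban1983to89
open T4Continuum BlockAveraging
open B10Eq27TorusAxialLog (gaugeActT gaugeActT_apply)
open B6SectADomainsV1 (Domains)
open B6SectAOperatorsV1 (BondIdx)
open Summit.QuantumFields.YangMills.Theorems.Prop8Chart (emlIterU emlIterU_gaugeActT)
open Summit.QuantumFields.YangMills.Theorems.Prop8ChartDoubleBar (vframeU vframeU_congr dbarIterU dbarIterU_eq_gaugeActT_emlIterU gaugeActT_gaugeActT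
  gaugeActT_const_one)
open Summit.QuantumFields.YangMills.Theorems.HalvingCompetitorMapTower (dbarIterU_eq_of_index_eq dbarIterU_top_eq_of_index_eq)

variable {P : Params} {𝔸 : Type*} [NormedRing 𝔸] [NormedAlgebra ℂ 𝔸] [CompleteSpace 𝔸]

/-! ## §1 Off `Ω_{j+1}` the frames of the two fields coincide -/

section Pinned

variable (D : Domains P)

/-- **OFF `Ω_{j+1}` THE TWO FRAMES COINCIDE**: if the constraint data of `W`, `W′` agree and the `(j+1)`-block `y` is not in `Ω_{j+1}` (`j + 1 ≤ k`), every level-`j` bond inside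
`y` is non-deep, so `U̿^{(j)}W = U̿^{(j)}W′` on them (✓tower pinning) and the block frames (110), which read exactly those bonds (✓`vframeU_congr`), agree.
[cite: Balaban1985Averaging, (110) p.34; Balaban1984PropagatorsII, (2.3) p.224] -/
theorem vframeU_dbarIterU_eq_of_not_mem_Om {W W' : GaugeField P 0 𝔸ˣ}
    (hidx : ∀ idx : BondIdx D, dbarIterU (idx.1.1 : ℕ) W idx.1.2 = dbarIterU (idx.1.1 : ℕ) W' idx.1.2)
    {j : ℕ} (hj : j + 1 ≤ D.k) (y : Site P (j + 1)) (hy : y ∉ D.Om (j + 1)) :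
    vframeU (dbarIterU j W) y = vframeU (dbarIterU j W') y :=
  vframeU_congr (le_trans hj D.hk) y fun b hs ht =>
    dbarIterU_eq_of_index_eq D hidx j (Nat.le_of_succ_le hj) b
      (show blockOf b.src ∉ D.Om (j + 1) by rw [hs]; exact hy) (show blockOf b.tgt ∉ D.Om (j + 1) by rw [ht]; exact hy)

end Pinned

/-! ## §2 Accumulated frames over small-readable blocks -/

section Small

variable (p : 𝔸ˣ → Prop)

/-- **ACCUMULATED FRAMES OVER SMALL-READABLE BLOCKS SATISFY `p`**: `Sm j ⊂ T^{(j)}` an `emb`-closed family («the block and the whole tower below its centre read small fields»)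
on which every block frame of `W` satisfies the multiplicative predicate `p` (`p 1`, closed under `*`); then every accumulated frame `V_j(W)(z)`, `z ∈ Sm j`, satisfies `p`
(recursion (97): `V_{j+1}(z) = V_j(emb z)·v(U̿^{(j)}W)(z)`). [cite: Balaban1985Averaging, (97) p.32, (110) p.34] -/
theorem accFrames_pred_of_small (h1 : p 1) (hmul : ∀ a b, p a → p b → p (a * b))
    (W : GaugeField P 0 𝔸ˣ) (V : (j : ℕ) → Site P j → 𝔸ˣ) (hV0 : ∀ x, V 0 x = 1)
    (hVs : ∀ (j : ℕ) (y : Site P (j + 1)), V (j + 1) y = V j (emb y) * vframeU (dbarIterU j W) y)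
    (Sm : (j : ℕ) → Set (Site P j)) (hemb : ∀ (j : ℕ) (z : Site P (j + 1)), z ∈ Sm (j + 1) → emb z ∈ Sm j)
    (hvf : ∀ (j : ℕ) (z : Site P (j + 1)), z ∈ Sm (j + 1) → p (vframeU (dbarIterU j W) z)) :
    ∀ (j : ℕ) (z : Site P j), z ∈ Sm j → p (V j z) := by
  intro j
  induction j with
  | zero => intro z _; rw [hV0]; exact h1
  | succ j ih => intro z hz; rw [hVs]; exact hmul _ _ (ih _ (hemb j z hz)) (hvf j z hz)

end Small

/-! ## §3 The frame quotient satisfies `p` everywhere -/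

section Quotient

variable (D : Domains P) (p : 𝔸ˣ → Prop)

/-- ★★ **THE FRAME QUOTIENT IS IN THE GROUP, LEVEL BY LEVEL.**  `p` multiplicative, inverse-closed, `p 1`; `Sm` an `emb`-closed family of small-readable blocks CONTAINING
`Ω_{j+1}` at every level `j + 1 ≤ k`, on which the block frames of BOTH fields satisfy `p`; constraint data of `W`, `W′` equal.  Then `p (V_j(W)(y)·V_j(W′)(y)⁻¹)` for every
`j ≤ k` and EVERY `y ∈ T^{(j)}`.  Induction: at a block `y ∈ Ω_{j+1}` write the quotient as `V_j(e)·[v·v′⁻¹]·V_j(e)⁻¹ · [V_j(e)·V′_j(e)⁻¹]`, `e = emb y`, with `p(V_j(e))` by §2;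
at `y ∉ Ω_{j+1}` the two block frames coincide (§1) and the quotient is the previous one at `e`. [cite: Balaban1985Averaging, (92) p.31, (97)-(100) p.32, (110) p.34] -/
theorem accFrames_quotient_pred (h1 : p 1) (hmul : ∀ a b, p a → p b → p (a * b)) (hinv : ∀ a, p a → p a⁻¹)
    {W W' : GaugeField P 0 𝔸ˣ} (hidx : ∀ idx : BondIdx D, dbarIterU (idx.1.1 : ℕ) W idx.1.2 = dbarIterU (idx.1.1 : ℕ) W' idx.1.2)
    (V : (j : ℕ) → Site P j → 𝔸ˣ) (hV0 : ∀ x, V 0 x = 1) (hVs : ∀ (j : ℕ) (y : Site P (j + 1)), V (j + 1) y = V j (emb y) * vframeU (dbarIterU j W) y)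
    (V' : (j : ℕ) → Site P j → 𝔸ˣ) (hV0' : ∀ x, V' 0 x = 1) (hVs' : ∀ (j : ℕ) (y : Site P (j + 1)), V' (j + 1) y = V' j (emb y) * vframeU (dbarIterU j W') y)
    (Sm : (j : ℕ) → Set (Site P j)) (hemb : ∀ (j : ℕ) (z : Site P (j + 1)), z ∈ Sm (j + 1) → emb z ∈ Sm j)
    (hΩ : ∀ (j : ℕ) (y : Site P (j + 1)), j + 1 ≤ D.k → y ∈ D.Om (j + 1) → y ∈ Sm (j + 1))
    (hvf : ∀ (j : ℕ) (z : Site P (j + 1)), z ∈ Sm (j + 1) → p (vframeU (dbarIterU j W) z))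
    (hvf' : ∀ (j : ℕ) (z : Site P (j + 1)), z ∈ Sm (j + 1) → p (vframeU (dbarIterU j W') z)) :
    ∀ (j : ℕ), j ≤ D.k → ∀ y : Site P j, p (V j y * (V' j y)⁻¹) := by
  intro j
  induction j with
  | zero => intro _ y; rw [hV0, hV0', inv_one, one_mul]; exact h1
  | succ j ih =>
    intro hj y
    have hq := ih (Nat.le_of_succ_le hj) (emb y)
    by_cases hy : y ∈ D.Om (j + 1)
    · -- small-readable block: every factor is in the group
      have hsm : y ∈ Sm (j + 1) := hΩ j y hj hy
      have hVe : p (V j (emb y)) := accFrames_pred_of_small p h1 hmul W V hV0 hVs Sm hemb hvf j (emb y) (hemb j y hsm)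
      have e : V (j + 1) y * (V' (j + 1) y)⁻¹ =
          (V j (emb y) * (vframeU (dbarIterU j W) y * (vframeU (dbarIterU j W') y)⁻¹) * (V j (emb y))⁻¹) * (V j (emb y) * (V' j (emb y))⁻¹) := by
        rw [hVs, hVs', mul_inv_rev]; group
      rw [e]
      exact hmul _ _ (hmul _ _ (hmul _ _ hVe (hmul _ _ (hvf j y hsm) (hinv _ (hvf' j y hsm)))) (hinv _ hVe)) hq
    · -- off `Ω_{j+1}`: the two block frames coincide
      have hvv : vframeU (dbarIterU j W) y = vframeU (dbarIterU j W') y := vframeU_dbarIterU_eq_of_not_mem_Om D hidx hj y hy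
      have e : V (j + 1) y * (V' (j + 1) y)⁻¹ = V j (emb y) * (V' j (emb y))⁻¹ := by
        rw [hVs, hVs', hvv, mul_inv_rev, mul_assoc, mul_inv_cancel_left]
      rw [e]
      exact hq

/-- ★ the frame quotient at the TOP level is in the group at every coarse site. [cite: Balaban1985Averaging, (97)-(100) p.32] -/
theorem accFrames_quotient_pred_top (h1 : p 1) (hmul : ∀ a b, p a → p b → p (a * b)) (hinv : ∀ a, p a → p a⁻¹)
    {W W' : GaugeField P 0 𝔸ˣ} (hidx : ∀ idx : BondIdx D, dbarIterU (idx.1.1 : ℕ) W idx.1.2 = dbarIterU (idx.1.1 : ℕ) W' idx.1.2)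
    (V : (j : ℕ) → Site P j → 𝔸ˣ) (hV0 : ∀ x, V 0 x = 1) (hVs : ∀ (j : ℕ) (y : Site P (j + 1)), V (j + 1) y = V j (emb y) * vframeU (dbarIterU j W) y)
    (V' : (j : ℕ) → Site P j → 𝔸ˣ) (hV0' : ∀ x, V' 0 x = 1) (hVs' : ∀ (j : ℕ) (y : Site P (j + 1)), V' (j + 1) y = V' j (emb y) * vframeU (dbarIterU j W') y)
    (Sm : (j : ℕ) → Set (Site P j)) (hemb : ∀ (j : ℕ) (z : Site P (j + 1)), z ∈ Sm (j + 1) → emb z ∈ Sm j)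
    (hΩ : ∀ (j : ℕ) (y : Site P (j + 1)), j + 1 ≤ D.k → y ∈ D.Om (j + 1) → y ∈ Sm (j + 1))
    (hvf : ∀ (j : ℕ) (z : Site P (j + 1)), z ∈ Sm (j + 1) → p (vframeU (dbarIterU j W) z))
    (hvf' : ∀ (j : ℕ) (z : Site P (j + 1)), z ∈ Sm (j + 1) → p (vframeU (dbarIterU j W') z)) (y : Site P D.k) :
    p (V D.k y * (V' D.k y)⁻¹) :=
  accFrames_quotient_pred D p h1 hmul hinv hidx V hV0 hVs V' hV0' hVs' Sm hemb hΩ hvf hvf' D.k le_rfl y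

end Quotient

/-! ## §4 The coarse gauge with explicit frames, and the conclusion -/

section Gauge

variable (D : Domains P)

/-- ★★ **THE COARSE GAUGE WITH EXPLICIT FRAMES**: for GIVEN accumulated frames `V`, `V′` of `W` and `W′ = (W₀)^{g₀}` and equal constraint data,
`Ū^{(k)} W = (Ū^{(k)} W₀)^{g}` with `g y = V_k(W)(y)·V_k(W′)(y)⁻¹·(g₀)_k(y)`, `(g₀)_k` the block-centre tower of `g₀` (any family `us` with `us 0 = g₀`, `us (i+1) y = us i (emb y)`).
[cite: Balaban1985Averaging, (11) p.19, (92) p.31, (97) p.32] -/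
theorem emlIterU_top_eq_gaugeActT_frames {W W₀ : GaugeField P 0 𝔸ˣ} (g₀ : GaugeTransf P 0 𝔸ˣ)
    (hidx : ∀ idx : BondIdx D, dbarIterU (idx.1.1 : ℕ) W idx.1.2 = dbarIterU (idx.1.1 : ℕ) (gaugeActT g₀ W₀) idx.1.2)
    (V : (j : ℕ) → Site P j → 𝔸ˣ) (hV0 : ∀ x, V 0 x = 1) (hVs : ∀ (j : ℕ) (y : Site P (j + 1)), V (j + 1) y = V j (emb y) * vframeU (dbarIterU j W) y)
    (V' : (j : ℕ) → Site P j → 𝔸ˣ) (hV0' : ∀ x, V' 0 x = 1)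
    (hVs' : ∀ (j : ℕ) (y : Site P (j + 1)), V' (j + 1) y = V' j (emb y) * vframeU (dbarIterU j (gaugeActT g₀ W₀)) y)
    (us : (i : ℕ) → GaugeTransf P i 𝔸ˣ) (hus0 : us 0 = g₀) (hus : ∀ (i : ℕ) (y : Site P (i + 1)), us (i + 1) y = us i (emb y)) :
    emlIterU D.k W = gaugeActT (fun y => V D.k y * (V' D.k y)⁻¹ * us D.k y) (emlIterU D.k W₀) := by
  have htop : dbarIterU D.k W = dbarIterU D.k (gaugeActT g₀ W₀) := funext fun c => dbarIterU_top_eq_of_index_eq D hidx c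
  have h1 : emlIterU D.k W = gaugeActT (fun y => V D.k y) (dbarIterU D.k W) := by
    rw [dbarIterU_eq_gaugeActT_emlIterU W V hV0 hVs D.k, gaugeActT_gaugeActT]
    have : (fun y : Site P D.k => V D.k y * (V D.k y)⁻¹) = fun _ => 1 := funext fun y => mul_inv_cancel _
    rw [this, gaugeActT_const_one]
  have hcov : emlIterU D.k (gaugeActT g₀ W₀) = gaugeActT (us D.k) (emlIterU D.k W₀) := by
    rw [← hus0]; exact emlIterU_gaugeActT us hus W₀ D.k
  rw [h1, htop, dbarIterU_eq_gaugeActT_emlIterU (gaugeActT g₀ W₀) V' hV0' hVs' D.k, hcov, gaugeActT_gaugeActT, gaugeActT_gaugeActT]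

/-- ★★★ **THE (Φ-1) FIBRE HALF, ALGEBRAIC∕GROUP FORM**: constraint data of `W` and of `(W₀)^{g₀}` equal; `p` a multiplicative inverse-closed predicate; the block frames of BOTH
towers satisfy `p` on an `emb`-closed family of blocks containing the `Ω`'s; `p` holds along the block-centre tower of `g₀`.  THEN there is a coarse gauge `g` with `p (g y)`
at every site and `Ū^{(k)} W = (Ū^{(k)} W₀)^{g}` — in the knit (`p` = «unitary, `det = 1`», `W` = localised competitor, `W₀` = minimiser, `g₀ = u⁻¹`): the competitor's
`k`-fold average is an `SU(2)`-gauge copy of the datum `V`, i.e. a fine `SU(2)` gauge copy of the competitor lies in `𝔅_k(V)`.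
[cite: Balaban1985Averaging, (11) p.19, (92) p.31, (97)-(100) p.32, (110) p.34; Balaban1985Variational, (6) p.278] -/
theorem exists_pred_gauge_emlIterU_top (p : 𝔸ˣ → Prop) (h1 : p 1) (hmul : ∀ a b, p a → p b → p (a * b)) (hinv : ∀ a, p a → p a⁻¹)
    {W W₀ : GaugeField P 0 𝔸ˣ} (g₀ : GaugeTransf P 0 𝔸ˣ)
    (hidx : ∀ idx : BondIdx D, dbarIterU (idx.1.1 : ℕ) W idx.1.2 = dbarIterU (idx.1.1 : ℕ) (gaugeActT g₀ W₀) idx.1.2)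
    (Sm : (j : ℕ) → Set (Site P j)) (hemb : ∀ (j : ℕ) (z : Site P (j + 1)), z ∈ Sm (j + 1) → emb z ∈ Sm j)
    (hΩ : ∀ (j : ℕ) (y : Site P (j + 1)), j + 1 ≤ D.k → y ∈ D.Om (j + 1) → y ∈ Sm (j + 1))
    (hvf : ∀ (j : ℕ) (z : Site P (j + 1)), z ∈ Sm (j + 1) → p (vframeU (dbarIterU j W) z))
    (hvf' : ∀ (j : ℕ) (z : Site P (j + 1)), z ∈ Sm (j + 1) → p (vframeU (dbarIterU j (gaugeActT g₀ W₀)) z))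
    (us : (i : ℕ) → GaugeTransf P i 𝔸ˣ) (hus0 : us 0 = g₀) (hus : ∀ (i : ℕ) (y : Site P (i + 1)), us (i + 1) y = us i (emb y))
    (hpus : ∀ y : Site P D.k, p (us D.k y)) :
    ∃ g : Site P D.k → 𝔸ˣ, (∀ y, p (g y)) ∧ emlIterU D.k W = gaugeActT g (emlIterU D.k W₀) := by
  obtain ⟨V, hV0, hVs, -⟩ := Prop8ChartDoubleBar.exists_accFrames_dbarIterU (P := P) W
  obtain ⟨V', hV0', hVs', -⟩ := Prop8ChartDoubleBar.exists_accFrames_dbarIterU (P := P) (gaugeActT g₀ W₀)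
  refine ⟨fun y => V D.k y * (V' D.k y)⁻¹ * us D.k y, fun y => hmul _ _ ?_ (hpus y),
    emlIterU_top_eq_gaugeActT_frames D g₀ hidx V hV0 hVs V' hV0' hVs' us hus0 hus⟩
  exact accFrames_quotient_pred_top D p h1 hmul hinv hidx V hV0 hVs V' hV0' hVs' Sm hemb hΩ hvf hvf' y

end Gauge

end Summit.QuantumFields.YangMills.Theorems.HalvingCompetitorMapFrames

end
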